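/-
Copyright: the b2b-balaban T⁴-continuum CRUX team, row NE7b OWNER lineage `t4-ne7b-p1` (gen 137). Project licence.
-/
import Summits.QuantumFields.BalabanUV.T4Continuum.Spine.NE7b.SupBlockTiltedGradientMoments
import Summits.QuantumFields.BalabanUV.T4Continuum.Spine.NE7b.SupBlockNextHessianMatrix
import Summits.QuantumFields.BalabanUV.T4Continuum.Spine.NE7b.SupDressedMeanShift

/-!
# THE DRESSED MEAN SHIFT OF A BLOCK INPUT IS SMALL — (392)'s BLOCK TWIN.  The extracted linear part `b_D(ψ₀)` of a block input ((404):
# `⟨b_D,v⟩ = Z⁻¹∫e^{−U}U′(ω+ψ₀)[v]`) is the Riesz vector of the gradient functional `Z⁻¹•∫e^{−U}•U′`, so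
#   `‖b_D(ψ₀)‖₂ ≤ ‖Z⁻¹•∫e^{−U}•U′‖ ≤ Z⁻¹∫e^{−U}‖U′‖ ≤ m₁(R)`   ((407)'s FIRST tilted gradient-moment letter, `Σ_Yψ₀² ≤ R`),
# `m₁(R) = κ₁((a+2R)+δ⁻¹)e^{κ₀(1+τ⁻¹)R}·A^{#Y}·e^{κ_u(a_u+Σ_YΓ_yy+R)}`; hence the next fluctuation measure's centre
# `m = −(S⁻¹+K_D)⁻¹b_D` of the block dressed step ((410)) obeys
#   `‖(S⁻¹+K_D(ψ₀))⁻¹b_D(ψ₀)‖ ≤ γ′∕(1−2λγ′)·m₁(R)`   ((392) `dressed_shift_norm_le` on (404)'s matrix letter `K_D + 2λ·1 ⪰ 0`)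
# — the translation that re-centres the next Gaussian ((392) `integral_shifted_gaussian`) moves the background by a controlled amount; for a
# `Y`-LOCAL `U` the sharper `β√#Y` form of (392) is the successor's locality file (row NE7b, node U5c; (392)∕(404)∕(407) BY NAME; [folklore])

Cell `pub-balaban`, sub-cell `t4`, spine estimate NE7b (`T4WeightBudget.RelWeightBound`; the cell's OWN estimate — NOT PRINTED in
[Bałaban 1983–89], NOT PROVED).  Crux-route work under `Spine/NE7b/` by the row OWNER (`t4-ne7b-p1` gen 137, file (411)) under FREEZE
(0)'s crux-prover clause, on gen 136's SCOPING-d8 (β2) for block inputs; NOTHING of Bałaban's is named as a Lean object, valued or asserted;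
no `T4Continuum/Support` leaf typed; no `def`, no notation (`b_D`, `K_D` WRITTEN OUT as in (404)); zero `sorry`.  Imports (BY NAME): the
OWNER's (407) `…SupBlockTiltedGradientMoments` (`block_tilted_gradient_moments`), (404) `…SupBlockNextHessianMatrix`
(`blockHessianMatrix_letters`), (392) `…SupDressedMeanShift` (`norm_toLp_sq_eq_dot`, `dressed_shift_norm_le`), and through them (406)
(`blockZ_pos`), (388) (`clm₁_apply_eq_dot`).

WHAT IS PROVED ([folklore]; `Z(ψ) = ∫e^{−U(ω+ψ)}dN(0,Γ)`):
* §1 **`block_gradient_opNorm_le`** (`‖Z(ψ₀)⁻¹•∫e^{−U}•U′(ω+ψ₀)‖ ≤ m₁(R)`), `block_gradient_dot_le` (`|⟨b_D(ψ₀),v⟩| ≤ m₁(R)‖v‖`),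
  **`block_gradient_norm_le`** (`‖b_D(ψ₀)‖₂ ≤ m₁(R)`);
* §2 THE END **`block_dressed_shift_small`**: under (404)'s hypotheses over `N(0,M⁻¹)` with `M⁻¹(y,y) ≤ γ` on `Y`, the upper growth letter,
  `Σ_Yψ₀² ≤ R`, and a next covariance `S ≻ 0`, `S ⪯ γ′·1`, `0 < γ′`, `2λγ′ < 1`:  `‖(S⁻¹+K_D(ψ₀))⁻¹b_D(ψ₀)‖ ≤ γ′∕(1−2λγ′)·m₁(R)`; §3 toy.

HONEST (what this is NOT).  A crude bound (`m₁` grows like `e^{O(R)}` — a small-field letter, and carries `A^{#Y}`); the `Y`-local sharpening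
(`b_D = 0` off `Y`) is the successor's; no contraction ((β4)), no decaying-covariance polymer expansion ((β3′)); scalar skeleton ((A3),
NC-NE7b-α UNRULED); nothing of Bałaban's asserted.  BY-NAME EFFECT ON THE WALL: NONE.  NE7b NOT PRINTED ∕ NOT PROVED; spine PROVED 0∕9; rung
(B)+1 — the programme's measures remain FINITE-torus statements; NOT the mass gap, NOT Clay.  HONEST DEPENDENCY: continuum YM on T⁴ ⇐
BetaPertH ∧ nine spine estimates (0∕9 proved); BetaPertH ⇐ (D1) ∧ (D4) ∧ CAP+tail; G-an2-4 gates asym, D1 and NE2∕3∕4.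
-/

set_option autoImplicit false
set_option maxSynthPendingDepth 2

noncomputable section

namespace Summit.QuantumFields.BalabanUV.T4Continuum.NE7b.SupBlockDressedMeanShift

open MeasureTheory ProbabilityTheory Finset Real Matrix
open scoped BigOperators
open SupBlockTiltedGradientMoments (block_tilted_gradient_moments)
open SupBlockNextHessianMatrix (blockHessianMatrix_letters)
open SupDressedMeanShift (norm_toLp_sq_eq_dot dressed_shift_norm_le)
open SupBlockThirdLetter (blockZ_pos)
open SupNextHessianMatrix (clm₁_apply_eq_dot)

variable {ι : Type} [Fintype ι] [DecidableEq ι]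

/-! ## §1. The extracted linear part of a block input is bounded by the first moment letter -/

section Gradient

variable {Γ : Matrix ι ι ℝ} {γop γ : ℝ} {U : EuclideanSpace ℝ ι → ℝ} {U' : EuclideanSpace ℝ ι → EuclideanSpace ℝ ι →L[ℝ] ℝ}
  {κ₀ κ₁ a κu au τ δ θ R : ℝ}

/-- **THE GRADIENT FUNCTIONAL IS BOUNDED BY THE FIRST MOMENT LETTER**: under (407)'s hypotheses (`k = 1`) and `Σ_Yψ₀² ≤ R`,
`‖Z(ψ₀)⁻¹ • ∫e^{−U(ω+ψ₀)}•U′(ω+ψ₀) dN(0,Γ)‖ ≤ m₁(R)`. [folklore] -/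
theorem block_gradient_opNorm_le (hΓ : Γ.PosSemidef) (hΓop : (γop • (1 : Matrix ι ι ℝ) - Γ).PosSemidef) (Y : Finset ι)
    (hdiag : ∀ i ∈ Y, Γ i i ≤ γ) (hUd : ∀ φ : EuclideanSpace ℝ ι, HasFDerivAt U (U' φ) φ) (hU'c : Continuous U')
    (hκ₀ : 0 ≤ κ₀) (hκ₁ : 0 ≤ κ₁) (ha : 0 ≤ a) (hκu : 0 ≤ κu) (hau : 0 ≤ au) (hτ : 0 < τ) (hδ : 0 < δ) (hθ0 : 0 < θ) (hθ1 : θ < 1)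
    (hκθ : (2 * κ₀ * (1 + τ) + 4 * δ) * γop ≤ θ) (hstab : ∀ φ : EuclideanSpace ℝ ι, -(κ₀ * ∑ x ∈ Y, φ x ^ 2) ≤ U φ)
    (hU'b : ∀ φ : EuclideanSpace ℝ ι, ‖U' φ‖ ≤ κ₁ * (a + ∑ x ∈ Y, φ x ^ 2))
    (hUup : ∀ φ : EuclideanSpace ℝ ι, U φ ≤ κu * (au + ∑ x ∈ Y, φ x ^ 2)) (ψ₀ : EuclideanSpace ℝ ι) (hR : ∑ x ∈ Y, ψ₀ x ^ 2 ≤ R) :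
    ‖((∫ ω : EuclideanSpace ℝ ι, exp (-U (ω + ψ₀)) ∂(multivariateGaussian 0 Γ))⁻¹ • ∫ ω : EuclideanSpace ℝ ι, exp (-U (ω + ψ₀)) • U' (ω + ψ₀) ∂(multivariateGaussian 0 Γ))‖
        ≤ ((κ₁ * ((a + 2 * R) + δ⁻¹) * exp (κ₀ * (1 + τ⁻¹) * R)) * ((1 - θ) ^ (-((2 * κ₀ * (1 + τ) + 4 * δ) * γ / (2 * θ)))) ^ Y.card * exp (κu * (au + ∑ x ∈ Y, Γ x x +
        R))) := by
  obtain ⟨⟨-, hm1⟩, -, -⟩ := block_tilted_gradient_moments hΓ hΓop Y hdiag hUd hU'c hκ₀ hκ₁ ha hκu hau hτ hδ hθ0 hθ1 hκθ hstab hU'b hUup ψ₀ hR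
  have hZ := (blockZ_pos hΓ hΓop Y hUd hκ₀ hτ hδ hθ0 hθ1 hκθ hstab ψ₀ ψ₀ 0).2
  simp only [zero_smul, add_zero] at hZ
  have hG : ‖∫ ω : EuclideanSpace ℝ ι, exp (-U (ω + ψ₀)) • U' (ω + ψ₀) ∂(multivariateGaussian 0 Γ)‖ ≤ (∫ ω : EuclideanSpace ℝ ι, exp (-U (ω + ψ₀)) * ‖U' (ω + ψ₀)‖
      ∂(multivariateGaussian 0 Γ)) := by
    refine (norm_integral_le_integral_norm _).trans (le_of_eq (integral_congr_ae (ae_of_all _ fun ω => ?_)))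
    dsimp only
    rw [norm_smul, Real.norm_eq_abs, abs_of_pos (exp_pos _)]
  rw [norm_smul, norm_inv, Real.norm_eq_abs, abs_of_pos hZ]
  calc (∫ ω : EuclideanSpace ℝ ι, exp (-U (ω + ψ₀)) ∂(multivariateGaussian 0 Γ))⁻¹ * ‖∫ ω : EuclideanSpace ℝ ι, exp (-U (ω + ψ₀)) • U' (ω + ψ₀) ∂(multivariateGaussian 0 Γ)‖
      ≤ (∫ ω : EuclideanSpace ℝ ι, exp (-U (ω + ψ₀)) ∂(multivariateGaussian 0 Γ))⁻¹ * ((∫ ω : EuclideanSpace ℝ ι, exp (-U (ω + ψ₀)) ∂(multivariateGaussian 0 Γ)) * ((κ₁ *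
          ((a + 2 * R) + δ⁻¹) * exp (κ₀ * (1 + τ⁻¹) * R)) * ((1 - θ) ^ (-((2 * κ₀ * (1 + τ) + 4 * δ) * γ / (2 * θ)))) ^ Y.card * exp (κu * (au + ∑ x ∈ Y, Γ x x + R)))) :=
          mul_le_mul_of_nonneg_left (hG.trans hm1) (inv_nonneg.2 hZ.le)
    _ = ((κ₁ * ((a + 2 * R) + δ⁻¹) * exp (κ₀ * (1 + τ⁻¹) * R)) * ((1 - θ) ^ (-((2 * κ₀ * (1 + τ) + 4 * δ) * γ / (2 * θ)))) ^ Y.card * exp (κu * (au + ∑ x ∈ Y, Γ x x + R)))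
        := by rw [← mul_assoc, inv_mul_cancel₀ hZ.ne', one_mul]

/-- **`|⟨b_D(ψ₀), v⟩| ≤ m₁(R)·‖v‖`** for every direction `v` ((388) `clm₁_apply_eq_dot` + the operator norm). [folklore] -/
theorem block_gradient_dot_le (hΓ : Γ.PosSemidef) (hΓop : (γop • (1 : Matrix ι ι ℝ) - Γ).PosSemidef) (Y : Finset ι)
    (hdiag : ∀ i ∈ Y, Γ i i ≤ γ) (hUd : ∀ φ : EuclideanSpace ℝ ι, HasFDerivAt U (U' φ) φ) (hU'c : Continuous U')
    (hκ₀ : 0 ≤ κ₀) (hκ₁ : 0 ≤ κ₁) (ha : 0 ≤ a) (hκu : 0 ≤ κu) (hau : 0 ≤ au) (hτ : 0 < τ) (hδ : 0 < δ) (hθ0 : 0 < θ) (hθ1 : θ < 1)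
    (hκθ : (2 * κ₀ * (1 + τ) + 4 * δ) * γop ≤ θ) (hstab : ∀ φ : EuclideanSpace ℝ ι, -(κ₀ * ∑ x ∈ Y, φ x ^ 2) ≤ U φ)
    (hU'b : ∀ φ : EuclideanSpace ℝ ι, ‖U' φ‖ ≤ κ₁ * (a + ∑ x ∈ Y, φ x ^ 2))
    (hUup : ∀ φ : EuclideanSpace ℝ ι, U φ ≤ κu * (au + ∑ x ∈ Y, φ x ^ 2)) (ψ₀ : EuclideanSpace ℝ ι) (hR : ∑ x ∈ Y, ψ₀ x ^ 2 ≤ R) (v : EuclideanSpace ℝ ι) :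
    |(fun x : ι => ((∫ ω : EuclideanSpace ℝ ι, exp (-U (ω + ψ₀)) ∂(multivariateGaussian 0 Γ))⁻¹ • ∫ ω : EuclideanSpace ℝ ι, exp (-U (ω + ψ₀)) • U' (ω + ψ₀)
        ∂(multivariateGaussian 0 Γ)) (EuclideanSpace.single x (1 : ℝ))) ⬝ᵥ (WithLp.ofLp v)| ≤ ((κ₁ * ((a + 2 * R) + δ⁻¹) * exp (κ₀ * (1 + τ⁻¹) * R)) * ((1 - θ) ^ (-((2 * κ₀
        * (1 + τ) + 4 * δ) * γ / (2 * θ)))) ^ Y.card * exp (κu * (au + ∑ x ∈ Y, Γ x x + R))) * ‖v‖ := by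
  rw [← clm₁_apply_eq_dot]
  have h := ContinuousLinearMap.le_opNorm ((∫ ω : EuclideanSpace ℝ ι, exp (-U (ω + ψ₀)) ∂(multivariateGaussian 0 Γ))⁻¹ • ∫ ω : EuclideanSpace ℝ ι, exp (-U (ω + ψ₀)) • U' (ω
      + ψ₀) ∂(multivariateGaussian 0 Γ)) v
  rw [Real.norm_eq_abs] at h
  exact h.trans (mul_le_mul_of_nonneg_right (block_gradient_opNorm_le hΓ hΓop Y hdiag hUd hU'c hκ₀ hκ₁ ha hκu hau hτ hδ hθ0 hθ1 hκθ hstab hU'b hUup ψ₀ hR) (norm_nonneg _))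

/-- **THE EXTRACTED LINEAR PART IS SMALL IN `ℓ²`**: `‖b_D(ψ₀)‖₂ ≤ m₁(R)` (the vector of (404) IS the Riesz vector of the gradient functional:
`‖b_D‖² = ⟨b_D,b_D⟩ = D(−log Z)(ψ₀)[b_D] ≤ m₁‖b_D‖`). [folklore] -/
theorem block_gradient_norm_le (hΓ : Γ.PosSemidef) (hΓop : (γop • (1 : Matrix ι ι ℝ) - Γ).PosSemidef) (Y : Finset ι)
    (hdiag : ∀ i ∈ Y, Γ i i ≤ γ) (hUd : ∀ φ : EuclideanSpace ℝ ι, HasFDerivAt U (U' φ) φ) (hU'c : Continuous U')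
    (hκ₀ : 0 ≤ κ₀) (hκ₁ : 0 ≤ κ₁) (ha : 0 ≤ a) (hκu : 0 ≤ κu) (hau : 0 ≤ au) (hτ : 0 < τ) (hδ : 0 < δ) (hθ0 : 0 < θ) (hθ1 : θ < 1)
    (hκθ : (2 * κ₀ * (1 + τ) + 4 * δ) * γop ≤ θ) (hstab : ∀ φ : EuclideanSpace ℝ ι, -(κ₀ * ∑ x ∈ Y, φ x ^ 2) ≤ U φ)
    (hU'b : ∀ φ : EuclideanSpace ℝ ι, ‖U' φ‖ ≤ κ₁ * (a + ∑ x ∈ Y, φ x ^ 2))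
    (hUup : ∀ φ : EuclideanSpace ℝ ι, U φ ≤ κu * (au + ∑ x ∈ Y, φ x ^ 2)) (ψ₀ : EuclideanSpace ℝ ι) (hR : ∑ x ∈ Y, ψ₀ x ^ 2 ≤ R) :
    ‖(WithLp.toLp 2 (fun x : ι => ((∫ ω : EuclideanSpace ℝ ι, exp (-U (ω + ψ₀)) ∂(multivariateGaussian 0 Γ))⁻¹ • ∫ ω : EuclideanSpace ℝ ι, exp (-U (ω + ψ₀)) • U' (ω + ψ₀)
        ∂(multivariateGaussian 0 Γ)) (EuclideanSpace.single x (1 : ℝ))) : EuclideanSpace ℝ ι)‖ ≤ ((κ₁ * ((a + 2 * R) + δ⁻¹) * exp (κ₀ * (1 + τ⁻¹) * R)) * ((1 - θ) ^ (-((2 *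
        κ₀ * (1 + τ) + 4 * δ) * γ / (2 * θ)))) ^ Y.card * exp (κu * (au + ∑ x ∈ Y, Γ x x + R))) := by
  have hdot := block_gradient_dot_le hΓ hΓop Y hdiag hUd hU'c hκ₀ hκ₁ ha hκu hau hτ hδ hθ0 hθ1 hκθ hstab hU'b hUup ψ₀ hR (WithLp.toLp 2 (fun x : ι => ((∫ ω : EuclideanSpace
      ℝ ι, exp (-U (ω + ψ₀)) ∂(multivariateGaussian 0 Γ))⁻¹ • ∫ ω : EuclideanSpace ℝ ι, exp (-U (ω + ψ₀)) • U' (ω + ψ₀) ∂(multivariateGaussian 0 Γ)) (EuclideanSpace.single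
      x (1 : ℝ))))
  rw [WithLp.ofLp_toLp, ← norm_toLp_sq_eq_dot, abs_of_nonneg (sq_nonneg _)] at hdot
  have hm0 : 0 ≤ ((κ₁ * ((a + 2 * R) + δ⁻¹) * exp (κ₀ * (1 + τ⁻¹) * R)) * ((1 - θ) ^ (-((2 * κ₀ * (1 + τ) + 4 * δ) * γ / (2 * θ)))) ^ Y.card * exp (κu * (au + ∑ x ∈ Y, Γ x
      x + R))) := (norm_nonneg _).trans (block_gradient_opNorm_le hΓ hΓop Y hdiag hUd hU'c hκ₀ hκ₁ ha hκu hau hτ hδ hθ0 hθ1 hκθ hstab hU'b hUup ψ₀ hR)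
  by_cases h0 : ‖(WithLp.toLp 2 (fun x : ι => ((∫ ω : EuclideanSpace ℝ ι, exp (-U (ω + ψ₀)) ∂(multivariateGaussian 0 Γ))⁻¹ • ∫ ω : EuclideanSpace ℝ ι, exp (-U (ω + ψ₀)) •
      U' (ω + ψ₀) ∂(multivariateGaussian 0 Γ)) (EuclideanSpace.single x (1 : ℝ))) : EuclideanSpace ℝ ι)‖ = 0
  · rw [h0]; exact hm0
  · have hpos := lt_of_le_of_ne (norm_nonneg _) (Ne.symm h0)
    rw [pow_two] at hdot
    exact le_of_mul_le_mul_right hdot hpos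

end Gradient

/-! ## §2. THE END: the dressed mean shift of a block input -/

section Shift

variable {M : Matrix ι ι ℝ} {γop γ m lam Λ : ℝ} {U : EuclideanSpace ℝ ι → ℝ} {U' : EuclideanSpace ℝ ι → EuclideanSpace ℝ ι →L[ℝ] ℝ}
  {U'' : EuclideanSpace ℝ ι → EuclideanSpace ℝ ι →L[ℝ] EuclideanSpace ℝ ι →L[ℝ] ℝ} {κ₀ κ₁ κ₂ a κu au τ δ θ R : ℝ}

/-- **THE END — THE DRESSED MEAN SHIFT OF A BLOCK INPUT IS SMALL.**  Under (404)'s hypotheses over `N(0,M⁻¹)` (`M ≻ 0` of floor `m`,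
`M⁻¹ ⪯ γ_op·1`, `M⁻¹(y,y) ≤ γ` on `Y`; `C²` block `U` with the block letters, the upper growth letter, the two-point upper letter `Λ ≥ 0`, the
secant lower letter `λ ≥ 0`, `2λ ≤ m`; the regulator margins), `Σ_Yψ₀² ≤ R`, and a NEXT covariance `S ≻ 0`, `γ′·1 − S ⪰ 0`, `0 < γ′`,
`2λγ′ < 1`:  `‖(S⁻¹ + K_D(ψ₀))⁻¹ b_D(ψ₀)‖ ≤ γ′∕(1 − 2λγ′)·m₁(R)`. [folklore] -/
theorem block_dressed_shift_small (hM : M.PosDef) (hfl : ∀ z : ι → ℝ, m * ∑ i, z i ^ 2 ≤ z ⬝ᵥ (M *ᵥ z)) (hΓop : (γop • (1 : Matrix ι ι ℝ) - M⁻¹).PosSemidef) (Y : Finset ι)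
    (hdiag : ∀ i ∈ Y, (M⁻¹) i i ≤ γ) (hUd : ∀ φ : EuclideanSpace ℝ ι, HasFDerivAt U (U' φ) φ) (hU'd : ∀ φ : EuclideanSpace ℝ ι, HasFDerivAt U' (U'' φ) φ)
    (hU''c : Continuous U'') (hκ₀ : 0 ≤ κ₀) (hκ₁ : 0 ≤ κ₁) (ha : 0 ≤ a) (hκ₂ : 0 ≤ κ₂) (hκu : 0 ≤ κu) (hau : 0 ≤ au) (hτ : 0 < τ) (hδ : 0 < δ)
    (hθ0 : 0 < θ) (hθ1 : θ < 1) (hκθ : (2 * κ₀ * (1 + τ) + 4 * δ) * γop ≤ θ) (hstab : ∀ φ : EuclideanSpace ℝ ι, -(κ₀ * ∑ x ∈ Y, φ x ^ 2) ≤ U φ)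
    (hU'b : ∀ φ : EuclideanSpace ℝ ι, ‖U' φ‖ ≤ κ₁ * (a + ∑ x ∈ Y, φ x ^ 2)) (hU''b : ∀ φ : EuclideanSpace ℝ ι, ‖U'' φ‖ ≤ κ₂)
    (hUup : ∀ φ : EuclideanSpace ℝ ι, U φ ≤ κu * (au + ∑ x ∈ Y, φ x ^ 2)) (hΛ : 0 ≤ Λ)
    (hwup : ∀ φ φ' : EuclideanSpace ℝ ι, U φ' ≤ U φ + U' φ (φ' - φ) + Λ / 2 * ∑ x ∈ Y, (φ' x - φ x) ^ 2) (hlam : 0 ≤ lam)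
    (hUsec : ∀ s : ℝ, 0 ≤ s → s ≤ 1 → ∀ a b : EuclideanSpace ℝ ι,
      U ((1 - s) • a + s • b) - lam / 2 * (s * (1 - s)) * ∑ i, (a i - b i) ^ 2 ≤ (1 - s) * U a + s * U b)
    (hm : 2 * lam ≤ m) (ψ₀ : EuclideanSpace ℝ ι) (hR : ∑ x ∈ Y, ψ₀ x ^ 2 ≤ R)
    {S : Matrix ι ι ℝ} {γ' : ℝ} (hS : S.PosDef) (hSγ : (γ' • (1 : Matrix ι ι ℝ) - S).PosSemidef) (hγ' : 0 < γ') (hsmall : 2 * lam * γ' < 1) :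
    ‖(WithLp.toLp 2 ((S⁻¹ + (Matrix.of fun x y : ι => (((∫ ω : EuclideanSpace ℝ ι, exp (-U (ω + ψ₀)) ∂(multivariateGaussian 0 M⁻¹))⁻¹ • (∫ ω : EuclideanSpace ℝ ι, exp (-U
        (ω + ψ₀)) • (U'' (ω + ψ₀) - (U' (ω + ψ₀)).smulRight (U' (ω + ψ₀))) ∂(multivariateGaussian 0 M⁻¹)) + (((∫ ω : EuclideanSpace ℝ ι, exp (-U (ω + ψ₀))
        ∂(multivariateGaussian 0 M⁻¹)) ^ 2)⁻¹ • ∫ ω : EuclideanSpace ℝ ι, exp (-U (ω + ψ₀)) • U' (ω + ψ₀) ∂(multivariateGaussian 0 M⁻¹)).smulRight (∫ ω : EuclideanSpace ℝ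
        ι, exp (-U (ω + ψ₀)) • U' (ω + ψ₀) ∂(multivariateGaussian 0 M⁻¹))) (EuclideanSpace.single x (1 : ℝ)) (EuclideanSpace.single y (1 : ℝ)) + ((∫ ω : EuclideanSpace ℝ ι,
        exp (-U (ω + ψ₀)) ∂(multivariateGaussian 0 M⁻¹))⁻¹ • (∫ ω : EuclideanSpace ℝ ι, exp (-U (ω + ψ₀)) • (U'' (ω + ψ₀) - (U' (ω + ψ₀)).smulRight (U' (ω + ψ₀)))
        ∂(multivariateGaussian 0 M⁻¹)) + (((∫ ω : EuclideanSpace ℝ ι, exp (-U (ω + ψ₀)) ∂(multivariateGaussian 0 M⁻¹)) ^ 2)⁻¹ • ∫ ω : EuclideanSpace ℝ ι, exp (-U (ω + ψ₀))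
        • U' (ω + ψ₀) ∂(multivariateGaussian 0 M⁻¹)).smulRight (∫ ω : EuclideanSpace ℝ ι, exp (-U (ω + ψ₀)) • U' (ω + ψ₀) ∂(multivariateGaussian 0 M⁻¹)))
        (EuclideanSpace.single y (1 : ℝ)) (EuclideanSpace.single x (1 : ℝ))) / 2))⁻¹ *ᵥ (fun x : ι => ((∫ ω : EuclideanSpace ℝ ι, exp (-U (ω + ψ₀)) ∂(multivariateGaussian 0
        M⁻¹))⁻¹ • ∫ ω : EuclideanSpace ℝ ι, exp (-U (ω + ψ₀)) • U' (ω + ψ₀) ∂(multivariateGaussian 0 M⁻¹)) (EuclideanSpace.single x (1 : ℝ)))) : EuclideanSpace ℝ ι)‖ ≤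
      γ' / (1 - 2 * lam * γ') * ((κ₁ * ((a + 2 * R) + δ⁻¹) * exp (κ₀ * (1 + τ⁻¹) * R)) * ((1 - θ) ^ (-((2 * κ₀ * (1 + τ) + 4 * δ) * γ / (2 * θ)))) ^ Y.card * exp (κu * (au
          + ∑ x ∈ Y, (M⁻¹) x x + R))) := by
  have hΓ : (M⁻¹).PosSemidef := hM.inv.posSemidef
  have hU'c : Continuous U' := continuous_iff_continuousAt.2 fun φ => (hU'd φ).continuousAt
  obtain ⟨-, hK, -⟩ := blockHessianMatrix_letters hM hfl hΓop Y hUd hU'd hU''c hκ₀ hκ₁ ha hκ₂ hτ hδ hθ0 hθ1 hκθ hstab hU'b hU''b hΛ hwup hlam hUsec hm ψ₀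
  have h := dressed_shift_norm_le hS hSγ hγ' hK hsmall (fun x : ι => ((∫ ω : EuclideanSpace ℝ ι, exp (-U (ω + ψ₀)) ∂(multivariateGaussian 0 M⁻¹))⁻¹ • ∫ ω : EuclideanSpace ℝ
      ι, exp (-U (ω + ψ₀)) • U' (ω + ψ₀) ∂(multivariateGaussian 0 M⁻¹)) (EuclideanSpace.single x (1 : ℝ)))
  have hb := block_gradient_norm_le hΓ hΓop Y hdiag hUd hU'c hκ₀ hκ₁ ha hκu hau hτ hδ hθ0 hθ1 hκθ hstab hU'b hUup ψ₀ hR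
  exact h.trans (mul_le_mul_of_nonneg_left hb (div_nonneg hγ'.le (by linarith)))

end Shift

/-! ## §3. Toy -/

/-- Toy (§1's last step): `a² ≤ m·a`, `0 < a` ⟹ `a ≤ m`. -/
example (a m : ℝ) (ha : 0 < a) (h : a * a ≤ m * a) : a ≤ m := le_of_mul_le_mul_right h ha

end Summit.QuantumFields.BalabanUV.T4Continuum.NE7b.SupBlockDressedMeanShift
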